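import Summits.CriticalPhenomena.PercolationContinuityZ3.Theorems.PercNearOneGluingNoHeavyLowerTailThreePointHalvingTransplant
import HarnessLib

/-!
# Transplant RECIPES: weight-preserving injections of pairs of bond configurations (Sahi programme, prover prim-sahi-p2 gen 52)

Support file (`--supports stmt-CriticalPhenomena-4575`, helper); the injections fed to the dictionary principle
`TransplantDictionary.core_le_of_cover` of `…ThreePointTransplantDictionary`.  Standard axioms, no sorries, no named facts.
Memo `run/shared/lean/prim/prim-sahi/FROM-prim-sahi-p2-gen52-TRANSPLANT-DICTIONARY.md`, `prim-sahi-p2/PROOF-E3.md` §62.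

WHAT IS PROVED (all graphs; pairs `θ = (θ₁, θ₂)` of configurations `BondConfig V`).
* `reachable_iff_of_agree`, `cutSet_eq_of_agree` — LOCALITY: the open cluster of `v` (and the set `cutSet v θ` of pairs meeting it,
  `ClusterConditioning.cutSet`) is determined by the configuration on `cutSet v θ`. [folklore]
* `swap F` (exchange the two copies on a pair set `F`), `swap_swap`; `wt2` = the product weight `w(θ₁)w(θ₂)` (the weight in the
  hypothesis of `core_le_of_cover`, by `rfl`), `wt2_swap` (it is invariant under every swap). [folklore]
* THE TRANSPLANT RECIPE `recipe x Y` [this work]: read the GHOST set `N = ⋃_{y ∈ Y} C_y(θ₂)` off copy 2 (`ghost`, `ghostVerts`); if `x ∈ N` do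
  nothing; else let `W = C_x(θ₁ ∖ ghost)` be the cluster of `x` in copy 1 with the pairs meeting `N` deleted, and swap the copies on
  `recipeSet = (pairs meeting W) ∖ (pairs meeting N)`.  **`recipeInv_recipe`**: the recipe has an explicit left inverse (read `N` AND `W` off
  the OUTPUT copy 2 — `ghost_swap_recipeSet`, `recipeInvSet_swap`), hence **`recipe_injective`**; **`wt2_recipe`**: it preserves the two-copy
  weight.  `recipe a {c}` / `recipe a {s}` restricted to `sac × s|a|c` are gen 43's two transplant bijections (`…HalvingTransplant`); the
  mirror `recipe'` reads the ghost off copy 1; words (`word_injective`, `wt2_word`) are injective and weight-preserving.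
So every finite set of words is an admissible family for `core_le_of_cover`; the 24 recipes `(x ∈ {s,a,c}, Y ⊆ other two, plain/mirror)`
and their 576 two-letter words are the dictionary of CONJECTURE DICT-2 (memo; 0 exceptions in 1.03·10⁹ enumerated pairs, kit j337630).
[cite: Gladkov2024, Def. 2.3–2.4 (cluster hybrids `C₁ →_S C₂`)]; [cite: VandenbergHaggstromKahn2005, §1 pp. 7–8 (the pairs meeting a cluster)].
-/

noncomputable section

open Classical

namespace Summit.CriticalPhenomena.PercolationContinuityZ3.Theorems

namespace TransplantRecipes

open MeasureTheory Finset
open Literature.Probability.Percolation Literature.Probability.LatticeModels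
open Literature.Probability.Percolation.BHK2006 (weight weight_nonneg)
open Literature.Probability.Percolation.DecisionTree (ind ind_of_mem ind_of_not_mem ind_nonneg)
open Literature.Probability.Percolation.ClusterConditioning (cutSet)

variable {V : Type*}

/-! ### 1. Locality of open clusters -/

/-- A set of vertices containing the start of a walk and closed under adjacency contains its end. [folklore] -/
theorem mem_of_walk {G : SimpleGraph V} {S : Set V} (hS : ∀ u w, u ∈ S → G.Adj u w → w ∈ S) :
    ∀ {u w : V} (_ : G.Walk u w), u ∈ S → w ∈ S
  | _, _, .nil, h => h
  | _, _, .cons h p, hu => mem_of_walk hS p (hS _ _ hu h)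

/-- A set containing `v` and closed under adjacency contains every vertex reachable from `v`. [folklore] -/
theorem mem_of_reachable {G : SimpleGraph V} {S : Set V} {v u : V} (hv : v ∈ S)
    (hS : ∀ u w, u ∈ S → G.Adj u w → w ∈ S) (h : G.Reachable v u) : u ∈ S := by
  obtain ⟨p⟩ := h
  exact mem_of_walk hS p hv

/-- One direction of locality: if `θ'` agrees with `θ` on the pairs meeting `C_v(θ)`, every `θ'`-connection of `v` is a `θ`-connection. [folklore] -/
theorem reachable_of_agree {v : V} {θ θ' : BondConfig V} (h : ∀ e ∈ cutSet v θ, (e ∈ θ' ↔ e ∈ θ)) {u : V}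
    (hu : (openGraph θ').Reachable v u) : (openGraph θ).Reachable v u := by
  refine mem_of_reachable (S := {u | (openGraph θ).Reachable v u}) (SimpleGraph.Reachable.refl v) ?_ hu
  intro u w hu' hadj
  rw [openGraph_adj] at hadj
  have hcut : s(u, w) ∈ cutSet v θ := ⟨u, Sym2.mem_mk_left u w, hu'⟩
  have he : s(u, w) ∈ θ := (h _ hcut).1 hadj.1
  exact hu'.trans (SimpleGraph.Adj.reachable ((openGraph_adj θ u w).2 ⟨he, hadj.2⟩))

/-- **Locality of the open cluster**: if `θ'` agrees with `θ` on the pairs meeting `C_v(θ)`, then `C_v(θ') = C_v(θ)`. [folklore] -/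
theorem reachable_iff_of_agree {v : V} {θ θ' : BondConfig V} (h : ∀ e ∈ cutSet v θ, (e ∈ θ' ↔ e ∈ θ)) (u : V) :
    (openGraph θ').Reachable v u ↔ (openGraph θ).Reachable v u := by
  refine ⟨reachable_of_agree h, fun hu => ?_⟩
  refine mem_of_reachable (S := {u | (openGraph θ').Reachable v u}) (SimpleGraph.Reachable.refl v) ?_ hu
  intro u w hu' hadj
  rw [openGraph_adj] at hadj
  have huθ : (openGraph θ).Reachable v u := reachable_of_agree h hu'
  have hcut : s(u, w) ∈ cutSet v θ := ⟨u, Sym2.mem_mk_left u w, huθ⟩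
  have he' : s(u, w) ∈ θ' := (h _ hcut).2 hadj.1
  exact hu'.trans (SimpleGraph.Adj.reachable ((openGraph_adj θ' u w).2 ⟨he', hadj.2⟩))

/-- **Locality of the cut set**: under the same agreement, the pairs meeting `C_v` coincide. [folklore] -/
theorem cutSet_eq_of_agree {v : V} {θ θ' : BondConfig V} (h : ∀ e ∈ cutSet v θ, (e ∈ θ' ↔ e ∈ θ)) :
    cutSet v θ' = cutSet v θ := by
  ext e
  simp only [cutSet, Set.mem_setOf_eq, reachable_iff_of_agree h]

/-! ### 2. Swapping the two copies on a set of pairs -/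

/-- Exchange the two copies on the pair set `F`. [folklore] -/
def swap (F : Set (Sym2 V)) (θ : BondConfig V × BondConfig V) : BondConfig V × BondConfig V :=
  ((θ.1 \ F) ∪ (θ.2 ∩ F), (θ.2 \ F) ∪ (θ.1 ∩ F))

/-- First copy after the swap. [folklore] -/
theorem mem_swap_fst (F : Set (Sym2 V)) (θ : BondConfig V × BondConfig V) (e : Sym2 V) :
    e ∈ (swap F θ).1 ↔ (e ∉ F ∧ e ∈ θ.1) ∨ (e ∈ F ∧ e ∈ θ.2) := by
  unfold swap
  simp only [Set.mem_union, Set.mem_sdiff, Set.mem_inter_iff]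
  tauto

/-- Second copy after the swap. [folklore] -/
theorem mem_swap_snd (F : Set (Sym2 V)) (θ : BondConfig V × BondConfig V) (e : Sym2 V) :
    e ∈ (swap F θ).2 ↔ (e ∉ F ∧ e ∈ θ.2) ∨ (e ∈ F ∧ e ∈ θ.1) := by
  unfold swap
  simp only [Set.mem_union, Set.mem_sdiff, Set.mem_inter_iff]
  tauto

/-- Off `F` nothing changes (first copy). [folklore] -/
theorem mem_swap_fst_of_not_mem {F : Set (Sym2 V)} (θ : BondConfig V × BondConfig V) {e : Sym2 V} (he : e ∉ F) :
    e ∈ (swap F θ).1 ↔ e ∈ θ.1 := by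
  rw [mem_swap_fst]; tauto

/-- Off `F` nothing changes (second copy). [folklore] -/
theorem mem_swap_snd_of_not_mem {F : Set (Sym2 V)} (θ : BondConfig V × BondConfig V) {e : Sym2 V} (he : e ∉ F) :
    e ∈ (swap F θ).2 ↔ e ∈ θ.2 := by
  rw [mem_swap_snd]; tauto

/-- On `F` the second copy receives the first. [folklore] -/
theorem mem_swap_snd_of_mem {F : Set (Sym2 V)} (θ : BondConfig V × BondConfig V) {e : Sym2 V} (he : e ∈ F) :
    e ∈ (swap F θ).2 ↔ e ∈ θ.1 := by
  rw [mem_swap_snd]; tauto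

/-- On `F` the first copy receives the second. [folklore] -/
theorem mem_swap_fst_of_mem {F : Set (Sym2 V)} (θ : BondConfig V × BondConfig V) {e : Sym2 V} (he : e ∈ F) :
    e ∈ (swap F θ).1 ↔ e ∈ θ.2 := by
  rw [mem_swap_fst]; tauto

/-- The swap is an involution. [folklore] -/
theorem swap_swap (F : Set (Sym2 V)) (θ : BondConfig V × BondConfig V) : swap F (swap F θ) = θ := by
  ext e
  · rw [mem_swap_fst, mem_swap_fst, mem_swap_snd]; tauto
  · rw [mem_swap_snd, mem_swap_snd, mem_swap_fst]; tauto

variable [Fintype V]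

/-- The two-copy product weight `w(θ₁)·w(θ₂)`. [folklore] -/
def wt2 (w : Sym2 V → ℝ) (θ : BondConfig V × BondConfig V) : ℝ := weight w θ.1 * weight w θ.2

/-- The two-copy weight is nonnegative for weights in `[0,1]`. [folklore] -/
theorem wt2_nonneg {w : Sym2 V → ℝ} (hw0 : ∀ e, 0 ≤ w e) (hw1 : ∀ e, w e ≤ 1) (θ : BondConfig V × BondConfig V) :
    0 ≤ wt2 w θ :=
  mul_nonneg (weight_nonneg hw0 hw1 _) (weight_nonneg hw0 hw1 _)

/-- The two-copy weight is symmetric in the copies. [folklore] -/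
theorem wt2_prodSwap (w : Sym2 V → ℝ) (θ : BondConfig V × BondConfig V) : wt2 w θ.swap = wt2 w θ := by
  unfold wt2; rw [Prod.fst_swap, Prod.snd_swap, mul_comm]

/-- **Swapping the copies on any pair set preserves the two-copy weight** (pair by pair the two factors are exchanged). [folklore] -/
theorem wt2_swap (w : Sym2 V → ℝ) (F : Set (Sym2 V)) (θ : BondConfig V × BondConfig V) :
    wt2 w (swap F θ) = wt2 w θ := by
  unfold wt2 weight
  rw [← Finset.prod_mul_distrib, ← Finset.prod_mul_distrib]
  refine Finset.prod_congr rfl fun e _ => ?_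
  by_cases hF : e ∈ F
  · have h1 : (e ∈ (swap F θ).1) = (e ∈ θ.2) := propext (mem_swap_fst_of_mem θ hF)
    have h2 : (e ∈ (swap F θ).2) = (e ∈ θ.1) := propext (mem_swap_snd_of_mem θ hF)
    rw [h1, h2, mul_comm]
  · have h1 : (e ∈ (swap F θ).1) = (e ∈ θ.1) := propext (mem_swap_fst_of_not_mem θ hF)
    have h2 : (e ∈ (swap F θ).2) = (e ∈ θ.2) := propext (mem_swap_snd_of_not_mem θ hF)
    rw [h1, h2]

/-! ### 3. The transplant recipe and its left inverse -/

omit [Fintype V] in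
/-- The pairs meeting one of the ghost clusters `C_y(θ₂)`, `y ∈ Y`. [this work] -/
def ghost (Y : Finset V) (θ₂ : BondConfig V) : Set (Sym2 V) := {e | ∃ y ∈ Y, e ∈ cutSet y θ₂}

omit [Fintype V] in
/-- The vertices of the ghost clusters `C_y(θ₂)`, `y ∈ Y`. [this work] -/
def ghostVerts (Y : Finset V) (θ₂ : BondConfig V) : Set V := {x | ∃ y ∈ Y, (openGraph θ₂).Reachable y x}

omit [Fintype V] in
/-- The swap set of the recipe read off a pair `(θ₁, θ₂)`: the pairs meeting the cluster of `x` in copy 1 WITH THE GHOST PAIRS DELETED, minus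
the ghost pairs. [this work] -/
def recipeSet (x : V) (Y : Finset V) (θ : BondConfig V × BondConfig V) : Set (Sym2 V) :=
  cutSet x (θ.1 \ ghost Y θ.2) \ ghost Y θ.2

omit [Fintype V] in
/-- The same set read off copy 2 alone (this is how the INVERSE finds it). [this work] -/
def recipeInvSet (x : V) (Y : Finset V) (θ : BondConfig V × BondConfig V) : Set (Sym2 V) :=
  cutSet x (θ.2 \ ghost Y θ.2) \ ghost Y θ.2

omit [Fintype V] in
/-- **THE TRANSPLANT RECIPE** `(x, Y)`: transplant the copy-1 cluster of `x` computed off the copy-2 ghost clusters of `Y` into copy 2 (and the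
corresponding copy-2 pairs into copy 1); do nothing if `x` is inside a ghost cluster. [this work; cf. Gladkov2024 Def. 2.3 (hybrids)] -/
def recipe (x : V) (Y : Finset V) (θ : BondConfig V × BondConfig V) : BondConfig V × BondConfig V :=
  if x ∈ ghostVerts Y θ.2 then θ else swap (recipeSet x Y θ) θ

omit [Fintype V] in
/-- The candidate inverse: the same operation with the swap set read off copy 2. [this work] -/
def recipeInv (x : V) (Y : Finset V) (θ : BondConfig V × BondConfig V) : BondConfig V × BondConfig V :=
  if x ∈ ghostVerts Y θ.2 then θ else swap (recipeInvSet x Y θ) θ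

omit [Fintype V] in
/-- The swap set avoids the ghost pairs. [this work] -/
theorem recipeSet_disjoint_ghost {x : V} {Y : Finset V} {θ : BondConfig V × BondConfig V} {e : Sym2 V}
    (he : e ∈ recipeSet x Y θ) : e ∉ ghost Y θ.2 := he.2

omit [Fintype V] in
/-- After the recipe, copy 2 agrees with the old copy 2 on every ghost pair. [this work] -/
theorem agree_on_ghost (x : V) (Y : Finset V) (θ : BondConfig V × BondConfig V) {e : Sym2 V} (he : e ∈ ghost Y θ.2) :
    e ∈ (swap (recipeSet x Y θ) θ).2 ↔ e ∈ θ.2 :=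
  mem_swap_snd_of_not_mem θ fun h => recipeSet_disjoint_ghost h he

omit [Fintype V] in
/-- The ghost clusters survive the recipe: `C_y(new copy 2) = C_y(θ₂)` for `y ∈ Y`. [this work] -/
theorem reachable_ghost_iff (x : V) (Y : Finset V) (θ : BondConfig V × BondConfig V) {y : V} (hy : y ∈ Y) (u : V) :
    (openGraph (swap (recipeSet x Y θ) θ).2).Reachable y u ↔ (openGraph θ.2).Reachable y u :=
  reachable_iff_of_agree (fun _ he => agree_on_ghost x Y θ ⟨y, hy, he⟩) u

omit [Fintype V] in
/-- Hence the ghost pair set is unchanged. [this work] -/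
theorem ghost_swap_recipeSet (x : V) (Y : Finset V) (θ : BondConfig V × BondConfig V) :
    ghost Y (swap (recipeSet x Y θ) θ).2 = ghost Y θ.2 := by
  ext e
  simp only [ghost, Set.mem_setOf_eq]
  constructor
  · rintro ⟨y, hy, he⟩
    exact ⟨y, hy, by rwa [cutSet_eq_of_agree (fun _ he' => agree_on_ghost x Y θ ⟨y, hy, he'⟩)] at he⟩
  · rintro ⟨y, hy, he⟩
    exact ⟨y, hy, by rwa [cutSet_eq_of_agree (fun _ he' => agree_on_ghost x Y θ ⟨y, hy, he'⟩)]⟩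

omit [Fintype V] in
/-- And so is the ghost vertex set (membership of `x`). [this work] -/
theorem mem_ghostVerts_swap_recipeSet (x : V) (Y : Finset V) (θ : BondConfig V × BondConfig V) :
    x ∈ ghostVerts Y (swap (recipeSet x Y θ) θ).2 ↔ x ∈ ghostVerts Y θ.2 := by
  simp only [ghostVerts, Set.mem_setOf_eq]
  constructor
  · rintro ⟨y, hy, h⟩; exact ⟨y, hy, (reachable_ghost_iff x Y θ hy x).1 h⟩
  · rintro ⟨y, hy, h⟩; exact ⟨y, hy, (reachable_ghost_iff x Y θ hy x).2 h⟩

omit [Fintype V] in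
/-- **The inverse reads the swap set off the output**: after the recipe, the cluster of `x` in (new copy 2) ∖ ghost is the old cluster of
`x` in (copy 1) ∖ ghost, so `recipeInvSet (recipe θ) = recipeSet θ`. [this work] -/
theorem recipeInvSet_swap (x : V) (Y : Finset V) (θ : BondConfig V × BondConfig V) :
    recipeInvSet x Y (swap (recipeSet x Y θ) θ) = recipeSet x Y θ := by
  have hg := ghost_swap_recipeSet x Y θ
  unfold recipeInvSet
  rw [hg]
  have hcut : cutSet x ((swap (recipeSet x Y θ) θ).2 \ ghost Y θ.2) = cutSet x (θ.1 \ ghost Y θ.2) := by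
    refine cutSet_eq_of_agree fun e he => ?_
    simp only [Set.mem_sdiff]
    by_cases hge : e ∈ ghost Y θ.2
    · constructor
      · rintro ⟨-, h⟩; exact absurd hge h
      · rintro ⟨-, h⟩; exact absurd hge h
    · have heF : e ∈ recipeSet x Y θ := ⟨he, hge⟩
      rw [mem_swap_snd_of_mem θ heF]
  rw [hcut]
  rfl

omit [Fintype V] in
/-- **LEFT INVERSE**: `recipeInv ∘ recipe = id`. [this work] -/
theorem recipeInv_recipe (x : V) (Y : Finset V) (θ : BondConfig V × BondConfig V) :
    recipeInv x Y (recipe x Y θ) = θ := by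
  unfold recipe
  by_cases hx : x ∈ ghostVerts Y θ.2
  · rw [if_pos hx]; unfold recipeInv; rw [if_pos hx]
  · rw [if_neg hx]
    unfold recipeInv
    rw [if_neg ((mem_ghostVerts_swap_recipeSet x Y θ).not.2 hx), recipeInvSet_swap, swap_swap]

omit [Fintype V] in
/-- **Every transplant recipe is INJECTIVE on `BondConfig V × BondConfig V`.** [this work] -/
theorem recipe_injective (x : V) (Y : Finset V) : Function.Injective (recipe (V := V) x Y) :=
  Function.LeftInverse.injective (recipeInv_recipe x Y)

/-- **Every transplant recipe preserves the two-copy weight.** [this work] -/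
theorem wt2_recipe (w : Sym2 V → ℝ) (x : V) (Y : Finset V) (θ : BondConfig V × BondConfig V) :
    wt2 w (recipe x Y θ) = wt2 w θ := by
  unfold recipe
  split_ifs
  · rfl
  · exact wt2_swap w _ θ

omit [Fintype V] in
/-- The MIRROR recipe: ghost read off copy 1, cluster off copy 2 (conjugation by `Prod.swap`). [this work] -/
def recipe' (x : V) (Y : Finset V) (θ : BondConfig V × BondConfig V) : BondConfig V × BondConfig V :=
  (recipe x Y θ.swap).swap

omit [Fintype V] in
/-- The mirror recipe is injective. [this work] -/
theorem recipe'_injective (x : V) (Y : Finset V) : Function.Injective (recipe' (V := V) x Y) := by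
  intro θ η h
  have h' : recipe x Y θ.swap = recipe x Y η.swap := by
    have := congrArg Prod.swap h
    simpa [recipe'] using this
  have := recipe_injective x Y h'
  simpa using congrArg Prod.swap this

/-- The mirror recipe preserves the two-copy weight. [this work] -/
theorem wt2_recipe' (w : Sym2 V → ℝ) (x : V) (Y : Finset V) (θ : BondConfig V × BondConfig V) :
    wt2 w (recipe' x Y θ) = wt2 w θ := by
  unfold recipe'
  rw [wt2_prodSwap, wt2_recipe, wt2_prodSwap]

omit [Fintype V] in
/-- Words: a composition of two weight-preserving injections is one (recorded for convenience). [folklore] -/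
theorem word_injective {f g : BondConfig V × BondConfig V → BondConfig V × BondConfig V}
    (hf : Function.Injective f) (hg : Function.Injective g) : Function.Injective (g ∘ f) :=
  hg.comp hf

/-- Words preserve the two-copy weight. [folklore] -/
theorem wt2_word {w : Sym2 V → ℝ} {f g : BondConfig V × BondConfig V → BondConfig V × BondConfig V}
    (hf : ∀ θ, wt2 w (f θ) = wt2 w θ) (hg : ∀ θ, wt2 w (g θ) = wt2 w θ) (θ : BondConfig V × BondConfig V) :
    wt2 w ((g ∘ f) θ) = wt2 w θ := by
  rw [Function.comp_apply, hg, hf]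

end TransplantRecipes

end Summit.CriticalPhenomena.PercolationContinuityZ3.Theorems

end
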